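/- Copyright: the b2b-balaban cell (near-miss cell 7), T⁴-continuum fan-out, lineage t4-ne7b-p1 (node U5c COUNT
member).  Released under the licence of the surrounding project. -/
import Summits.QuantumFields.BalabanUV.T4Continuum.Support.HistoryGenealogyPedigreeTrack

/-!
# THE PEDIGREE OF A COMPONENT HISTORY, part 7 (junction M4, brick 3a — root cells): the root cell of every component's
`PGen` is one of print's new regions, born at the root step (owner module of row NE7b, lineage `t4-ne7b-p1` gen 41;
re-open object (α), `SCOPE-alpha.md` v2.3 §5 row M4, D-M4-4 — PRE-POSITIONING ONLY)

Summits-side support leaf of the T⁴-continuum cell (rung (B)+1 on a FINITE torus only; NOT infinite volume, NOT the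
mass gap, NOT the Clay statement; NOT a proof of the spine estimate NE7b, which is the cell's OWN estimate, NOT PRINTED
and NOT PROVED).  [folklore] finite combinatorics in the ℤᵈ index model over parts 1–6 (`pedOf`, `ordOf`, `ppair`,
`rootStep_rootCell_chainJoin_of_head_min`, `rootStep_head_le_ordOf`); nothing printed is asserted, zero `sorry`.

WHY.  The END's field `inBox` asks that the ROOT ANCHOR of a live structure (the anchor cube of its first-born
constituent) lie in the period box at its birth scale; for the process this follows from a displayed box condition on
the INPUT regions once the root cell is identified as one of them: **`rootCell_toPGen_mem_newReg`** — by induction on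
the level through print's trichotomy, the root cell of `toPGen id (j, c)` is a member of `newReg (rootStep)` and
`rootStep ≤ j` (lone part: inherited; lone birth: itself; chain: the head's, which has minimal root step).

HONEST.  Proves nothing of Bałaban's; NE7b NOT proved; spine 0∕9.  HONEST DEPENDENCY (cell): continuum YM on T⁴ ⇐
BetaPertH ∧ nine spine estimates (0/9 proved); BetaPertH ⇐ (D1) ∧ (D4) ∧ CAP+tail; G-an2-4 gates asym, D1 and NE2/3/4.
This file changes none of it. -/

open Finset
open Literature.MathematicalPhysics.QuantumFieldTheory.Balaban1983to89
open Literature.MathematicalPhysics.QuantumFieldTheory.Balaban1983to89.B13ScaleTransfer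
open Literature.MathematicalPhysics.QuantumFieldTheory.Balaban1983to89.B16SProfile
open Literature.MathematicalPhysics.QuantumFieldTheory.Balaban1983to89.B16MergeGeometry
open T4PersistenceDictionary
open Summit.QuantumFields.BalabanUV.T4Continuum.HistoryAdmissible
open Summit.QuantumFields.BalabanUV.T4Continuum.HistoryRealise
open Summit.QuantumFields.BalabanUV.T4Continuum.HistoryRealiseWeak
open Summit.QuantumFields.BalabanUV.T4Continuum.HistoryRealiseCells
open Summit.QuantumFields.BalabanUV.T4Continuum.HistoryGen
open Summit.QuantumFields.BalabanUV.T4Continuum.HistoryGenealogyExtraction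
open Summit.QuantumFields.BalabanUV.T4Continuum.HistoryGenealogyRealise
open Summit.QuantumFields.BalabanUV.T4Continuum.HistoryGenealogyRealise.GeomHistoryR

namespace Summit.QuantumFields.BalabanUV.T4Continuum.HistoryGenealogyPedigree

noncomputable section

variable {d : ℕ}

/-! ## §4 The root cell is one of print's new regions, born at the root step -/

section RootCell

variable {L : ℕ} {s R : ℕ → ℕ} {H : ComponentHistory (Lab d)} {rnw : ℕ → Lab d → Bool}
  {dom : ℕ → Lab d → Finset (Pt d)}

/-- **THE ROOT CELL OF A COMPONENT'S `PGen` IS A NEW REGION OF PRINT'S BOOKKEEPING BORN AT THE ROOT STEP** (chosen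
order; under `WF` and the clauses). [folklore] -/
theorem rootCell_toPGen_mem_newReg (hW : H.WF) (hG : LevelClausesW H rnw dom L s R) :
    ∀ (j : ℕ) (c : Lab d), c ∈ H.comp j →
      ((pedOf H rnw (ordOf H rnw dom L s)).toPGen id (j, c)).rootStep ≤ j ∧
        ((pedOf H rnw (ordOf H rnw dom L s)).toPGen id (j, c)).rootCell ∈
          H.newReg ((pedOf H rnw (ordOf H rnw dom L s)).toPGen id (j, c)).rootStep := by
  have hO := orderOK_ordOf hW hG (rnw := rnw)
  set ord := ordOf H rnw dom L s with hord
  intro j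
  induction j with
  | zero =>
      intro c hc
      have hl0 : lefts (ord 0 c) = [] := lefts_ord_zero hW hO hc
      have hmem : ∀ x ∈ ord 0 c, ∃ n, x = Sum.inr n ∧ n ∈ H.newReg 0 := by
        intro x hx
        obtain ⟨n, rfl⟩ := exists_inr_of_lefts_eq_nil hl0 x hx
        exact ⟨n, rfl, hW.news_sub 0 c hc n (mem_news_of_inr_mem_ord hO hc hx)⟩
      obtain ⟨q₀, qs, hqs⟩ := List.exists_cons_of_ne_nil (ord_ne_nil hW hO hc)
      obtain ⟨n₀, rfl, hn₀⟩ := hmem q₀ (by rw [hqs]; exact List.mem_cons_self)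
      have hrights : (rights (ord 0 c)).map (fun n => PGen.birth 0 (H.cls n) (id n)) =
          (ord 0 c).map (Sum.elim (fun p => (pedOf H rnw ord).toPGen id (0, p)) fun n => PGen.birth 0 (H.cls n) n) :=
        (map_sum_elim_of_lefts_eq_nil _ _ _ hl0).symm
      cases qs with
      | nil =>
          have hr : rights (ord 0 c) = [n₀] := by rw [hqs]; rfl
          rw [toPGen_zero_birth H rnw ord id hc hr]
          simpa [PGen.rootStep, PGen.rootCell] using hn₀
      | cons q₁ qs' =>
          have hchain : (pedOf H rnw ord).toPGen id (0, c) =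
              chainJoin (PGen.birth 0 (H.cls n₀) n₀)
                ((q₁ :: qs').map (Sum.elim (fun p => (pedOf H rnw ord).toPGen id (0, p)) fun n =>
                  PGen.birth 0 (H.cls n) n)) 0 := by
            rw [toPGen_zero H rnw ord id hc, hrights, hqs]; rfl
          have hmin : ∀ B ∈ (q₁ :: qs').map (Sum.elim (fun p => (pedOf H rnw ord).toPGen id (0, p)) fun n =>
              PGen.birth 0 (H.cls n) n), (PGen.birth 0 (H.cls n₀) n₀).rootStep ≤ B.rootStep := by
            intro B hB
            obtain ⟨x, hx, rfl⟩ := List.mem_map.1 hB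
            obtain ⟨n, rfl, -⟩ := hmem x (by rw [hqs]; exact List.mem_cons_of_mem _ hx)
            simp [PGen.rootStep]
          obtain ⟨hrs, hrc⟩ := rootStep_rootCell_chainJoin_of_head_min 0 _ _ hmin
          rw [hchain, hrs, hrc]
          simpa [PGen.rootStep, PGen.rootCell] using hn₀
  | succ j ih =>
      intro c hc
      obtain ⟨q₀, qs, hqs⟩ := List.exists_cons_of_ne_nil (ord_ne_nil hW hO hc)
      have hold : ∀ p ∈ H.parts (j + 1) c,
          ((pedOf H rnw ord).toPGen id (j, p)).rootStep ≤ j + 1 ∧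
            ((pedOf H rnw ord).toPGen id (j, p)).rootCell ∈
              H.newReg ((pedOf H rnw ord).toPGen id (j, p)).rootStep := by
        intro p hp
        obtain ⟨h1, h2⟩ := ih p (hW.parts_sub j c hc p hp)
        exact ⟨h1.trans (Nat.le_succ j), h2⟩
      cases qs with
      | nil =>
          have hcs := constit_eq_singleton_of_ord hO hc hqs
          cases q₀ with
          | inl p =>
              have hp : p ∈ H.parts (j + 1) c := by simp [ComponentHistory.parts, hcs]
              cases hf : rnw j p with
              | false => rw [toPGen_succ_lone H rnw ord id hc hqs hf]; exact hold p hp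
              | true =>
                  rw [toPGen_succ_renew H rnw ord id hc hqs hf]
                  simpa [PGen.rootStep, PGen.rootCell] using hold p hp
          | inr n =>
              have hn : n ∈ H.newReg (j + 1) := hW.news_sub (j + 1) c hc n (by simp [ComponentHistory.news, hcs])
              rw [toPGen_succ_birth H rnw ord id hc hqs]
              simpa [PGen.rootStep, PGen.rootCell] using hn
      | cons q₁ qs' =>
          have hchain : (pedOf H rnw ord).toPGen id (j + 1, c) =
              chainJoin (ppair H rnw ord dom L s j q₀).1 ((q₁ :: qs').map fun x => (ppair H rnw ord dom L s j x).1)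
                (j + 1) := by
            rw [toPGen_succ_chain H rnw ord id hc hqs, fst_ppair]
            congr 1
            exact List.map_congr_left fun x _ => (fst_ppair j x).symm
          have hmin : ∀ B ∈ (q₁ :: qs').map (fun x => (ppair H rnw ord dom L s j x).1),
              (ppair H rnw ord dom L s j q₀).1.rootStep ≤ B.rootStep := by
            intro B hB
            obtain ⟨x, hx, rfl⟩ := List.mem_map.1 hB
            exact rootStep_head_le_ordOf hW hG hc hqs x hx
          obtain ⟨hrs, hrc⟩ := rootStep_rootCell_chainJoin_of_head_min (j + 1) _ _ hmin
          have hq₀c : q₀ ∈ H.constit (j + 1) c := (hO (j + 1) c hc).mem_iff.1 (by rw [hqs]; exact List.mem_cons_self)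
          rw [hchain, hrs, hrc, rootStep_fst_ppair, rootCell_fst_ppair]
          cases q₀ with
          | inr n =>
              simpa using hW.news_sub (j + 1) c hc n ((mem_rights_iff n _).2 hq₀c)
          | inl p =>
              simp only [Sum.elim_inl]
              exact hold p ((mem_lefts_iff p _).2 hq₀c)

/-- the root step of a live component's `PGen` is at most its level (chosen order) [folklore] -/
theorem rootStep_toPGen_ordOf_le (hW : H.WF) (hG : LevelClausesW H rnw dom L s R) {j : ℕ} {c : Lab d}
    (hc : c ∈ H.comp j) : ((pedOf H rnw (ordOf H rnw dom L s)).toPGen id (j, c)).rootStep ≤ j :=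
  (rootCell_toPGen_mem_newReg hW hG j c hc).1

end RootCell

end

end Summit.QuantumFields.BalabanUV.T4Continuum.HistoryGenealogyPedigree
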